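import Summits.Ventures.QEC.Census.FoldTowerPlan
import HarnessLib

/-!
# Fold certificate of `[[288,12,18]]` — level-4 file 0: 3 theorem(s) over plan segments

Kernel computation only (`decide +kernel`, standard axioms); each theorem's work list is a segment of the plan in
`FoldTowerPlan`; assembled in the closer via `FoldTowerSound`.
-/

set_option maxRecDepth 100000

namespace Summit.Ventures.QEC.Census.Fold.Tower

open Summit.Ventures.QEC.Census Summit.Ventures.QEC.Census.Fold

set_option maxHeartbeats 400000000 in
/-- the 1456 level-4 work unit(s) `seg4 0 1456` pass `node4Mod` (est. 135 s). -/
theorem l4c0 : runPlan node4Mod (seg4 0 1456) = true := by decide +kernel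

set_option maxHeartbeats 400000000 in
/-- the 1465 level-4 work unit(s) `seg4 1456 1465` pass `node4Mod` (est. 135 s). -/
theorem l4c1 : runPlan node4Mod (seg4 1456 1465) = true := by decide +kernel

set_option maxHeartbeats 400000000 in
/-- the 803 level-4 work unit(s) `seg4 2921 803` pass `node4Mod` (est. 83 s). -/
theorem l4c2 : runPlan node4Mod (seg4 2921 803) = true := by decide +kernel


end Summit.Ventures.QEC.Census.Fold.Tower
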